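import Literature.Probability.Distributions.BrascampLiebCutoff

/-!
# `Balaban1983to89.B9Eq343PlateauProfile` — T. Bałaban, *Propagators for lattice gauge theories in a background field*, Commun. Math. Phys. **99** (1985)
# 389–434 [Balaban1985BackgroundPropagators] (3.43)–(3.46) p. 398 (localisation of the resolvent by smooth cutoffs of the cubes: print's random walk uses a
# partition of unity `h_□` with bounded lattice derivatives): **A CONCRETE `C^{1,1}` PLATEAU PROFILE — for `α ≤ β` and a ramp width `w > 0` there is
# `g : ℝ → ℝ`, differentiable everywhere, `0 ≤ g ≤ 1`, `g = 1` on `[α, β]`, `g = 0` off `(α − w, β + w)`, `|g′| ≤ 2∕w`, `g′` `(8∕w²)`-Lipschitz** — the INPUT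
# of this lineage's cutoff supplier chain for storey J: `B9Eq343ProfileLetters` (a `C^{1,1}` function sampled at spacing `1∕(rt)` has the t-FREE difference
# letters `L₁∕r`, `2L₂∕r²`) → `B9Eq343ProfileChartLetters` (chart placement) → `B9Eq343ProductCutoffLetters` (the product cutoff `χ_{b₀}` of
# `B9Eq342GradientRowAssembly` with `c∕r = L₁∕r`, `c∕r² = 2L₂∕r²`); here `L₁ = 2∕w`, `L₂ = 8∕w²` (successor memo
# `t4/b2b-balaban-t4-ne9-formalise-leaf-05/g84/V28-NEXT.md` item 4: «what remains for an INSTANCE: name the bump»)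

statement-level skeleton of published theorems with citation tags; proofs where landed; nothing here is a claim about the Yang–Mills mass gap

CITATION HEADER (lean-in-tree rule).  Audit cell `pub-balaban`, sub-cell `t4`, BINDER row NE9; filed by NE9 crux-team LEAF PROVER 05
(`b2b-balaban-t4-ne9-formalise-leaf-05`, gen 85).  Imports `Literature.Probability.Distributions.BrascampLiebCutoff` ONLY, for its [folklore]
`hasDerivAt_posPart_pow` (`t ↦ (max t 0)ⁿ` is `C¹` for `n ≥ 2`) — reused, not restated.  SOURCE READ first-hand in the held text layer
[Balaban1985BackgroundPropagators] (`paper:balaban1985-cmp99-background-propagators`): p. 398 (3.43)–(3.46).  Print's cutoffs are any smooth partition of unity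
adapted to the cubes; the cell's storey J (t4-ne9-idea-1 N17 ∕ N22 ∕ N44–N46; this lineage g77–g85) needs ONE plateau per coordinate with t-free lattice
letters, which a `C^{1,1}` profile gives (`B9Eq343ProfileLetters`); the piecewise-quadratic smoothstep below is the cell's choice — [folklore] calculus; nothing
printed is a hypothesis; the `[cite: …]` tags are TEXT LOCATIONS.

WHAT IS PROVED (sorry-free; 0 `def` — the two profiles are written INLINE; [folklore]).
* §1 the smoothstep `S(y) = 2·((y)₊² − 2(y − ½)₊² + (y − 1)₊²)` (`(·)₊ = max · 0`): **`hasDerivAt_smoothstep`** (`S′(y) = 4·T(y)`, `T(y) = y₊ − 2(y − ½)₊ + (y − 1)₊`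
  the tent), `smoothstep_of_nonpos` (`= 0` for `y ≤ 0`), `smoothstep_of_one_le` (`= 1` for `y ≥ 1`), `smoothstep_nonneg`, `smoothstep_le_one`;
  the tent: `tent_eq_min` (`T(y) = min(y₊, (1 − y)₊)`), `tent_nonneg`, `tent_le_half`, `tent_of_nonpos`, `tent_of_one_le`, **`abs_tent_sub_tent_le`**
  (`T` is 1-Lipschitz).
* §2 **`exists_plateau_profile`** — `α ≤ β`, `0 < w` ⟹ `∃ g g′`, `HasDerivAt g (g′ x) x` for all `x`, `0 ≤ g ≤ 1`, `|g′| ≤ 2∕w`, `|g′(x) − g′(y)| ≤ (8∕w²)|x − y|`,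
  `g = 1` on `[α, β]`, `g = 0` on `(−∞, α − w]` and on `[β + w, ∞)` (witness `g(x) = S((x − α + w)∕w) + S((β + w − x)∕w) − 1`).
HONEST SCOPE.  Elementary calculus; constants crude (`L₂ = 8∕w²`, the sharp value is `4∕w²`); the chart placement (vanishing within two sites of the chart
ends) and the cube geometry that pick `α, β, w, r` per output bond are NOT here.  Nothing of [B9] is asserted.  NOT NE9 (cell pub-balaban: NE9 NOT PRINTED ∕
NOT PROVED; «NE9 ⇐ the named binders»; row WALLED ON A MODEL (O-NE9-1; #5 UNRULED); spine PROVED 0∕9; rung (B)+1 on a finite T⁴ — NOT infinite volume, NOT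
mass gap, NOT Clay; HONEST DEPENDENCY: continuum YM on T⁴ ⇐ BetaPertH ∧ nine spine estimates (0/9 proved); BetaPertH ⇐ (D1) ∧ (D4) ∧ CAP+tail; G-an2-4
gates asym, D1 and NE2/3/4).  NEW file; nothing modified.  Net new unproved facts: 0.
-/

noncomputable section

set_option autoImplicit false

namespace Literature.MathematicalPhysics.QuantumFieldTheory.Balaban1983to89.B9Eq343PlateauProfile

open Literature.Probability.Distributions.BrascampLiebCutoff (hasDerivAt_posPart_pow)

/-! ## §1 The piecewise-quadratic smoothstep and its tent derivative -/

/-- `(max t 0)²` has derivative `2·max t 0`. [folklore] [cite: Balaban1985BackgroundPropagators, (3.43) p.398] -/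
theorem hasDerivAt_posPart_sq (t : ℝ) : HasDerivAt (fun s : ℝ => max s 0 ^ 2) (2 * max t 0) t := by
  have h := hasDerivAt_posPart_pow (n := 2) le_rfl t
  simp only [Nat.cast_ofNat, Nat.add_one_sub_one, pow_one] at h
  exact h

/-- **`S′ = 4T`**: the smoothstep `S(y) = 2·(y₊² − 2(y − ½)₊² + (y − 1)₊²)` has derivative `4·(y₊ − 2(y − ½)₊ + (y − 1)₊)` everywhere. [folklore]
[cite: Balaban1985BackgroundPropagators, (3.43) p.398] -/
theorem hasDerivAt_smoothstep (y : ℝ) :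
    HasDerivAt (fun s : ℝ => 2 * (max s 0 ^ 2 - 2 * max (s - 1 / 2) 0 ^ 2 + max (s - 1) 0 ^ 2))
      (4 * (max y 0 - 2 * max (y - 1 / 2) 0 + max (y - 1) 0)) y := by
  have h0 := hasDerivAt_posPart_sq y
  have h1 : HasDerivAt (fun s : ℝ => max (s - 1 / 2) 0 ^ 2) (2 * max (y - 1 / 2) 0) y :=
    (hasDerivAt_posPart_sq (y - 1 / 2)).comp_sub_const y (1 / 2)
  have h2 : HasDerivAt (fun s : ℝ => max (s - 1) 0 ^ 2) (2 * max (y - 1) 0) y :=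
    (hasDerivAt_posPart_sq (y - 1)).comp_sub_const y 1
  have h := ((h0.sub (h1.const_mul 2)).add h2).const_mul 2
  refine h.congr_deriv ?_
  ring

/-- `S(y) = 0` for `y ≤ 0`. [folklore] [cite: Balaban1985BackgroundPropagators, (3.43) p.398] -/
theorem smoothstep_of_nonpos {y : ℝ} (hy : y ≤ 0) : 2 * (max y 0 ^ 2 - 2 * max (y - 1 / 2) 0 ^ 2 + max (y - 1) 0 ^ 2) = 0 := by
  rw [max_eq_right hy, max_eq_right (by linarith), max_eq_right (by linarith)]; ring

/-- `S(y) = 1` for `y ≥ 1`. [folklore] [cite: Balaban1985BackgroundPropagators, (3.43) p.398] -/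
theorem smoothstep_of_one_le {y : ℝ} (hy : 1 ≤ y) : 2 * (max y 0 ^ 2 - 2 * max (y - 1 / 2) 0 ^ 2 + max (y - 1) 0 ^ 2) = 1 := by
  rw [max_eq_left (by linarith), max_eq_left (by linarith), max_eq_left (by linarith)]; ring

/-- `0 ≤ S(y)`. [folklore] [cite: Balaban1985BackgroundPropagators, (3.43) p.398] -/
theorem smoothstep_nonneg (y : ℝ) : 0 ≤ 2 * (max y 0 ^ 2 - 2 * max (y - 1 / 2) 0 ^ 2 + max (y - 1) 0 ^ 2) := by
  rcases le_or_gt y 0 with h0 | h0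
  · rw [smoothstep_of_nonpos h0]
  rcases le_or_gt y (1 / 2) with h1 | h1
  · rw [max_eq_left h0.le, max_eq_right (by linarith), max_eq_right (by linarith)]; nlinarith
  rcases le_or_gt y 1 with h2 | h2
  · rw [max_eq_left h0.le, max_eq_left (by linarith), max_eq_right (by linarith)]; nlinarith
  · rw [smoothstep_of_one_le h2.le]; norm_num

/-- `S(y) ≤ 1`. [folklore] [cite: Balaban1985BackgroundPropagators, (3.43) p.398] -/
theorem smoothstep_le_one (y : ℝ) : 2 * (max y 0 ^ 2 - 2 * max (y - 1 / 2) 0 ^ 2 + max (y - 1) 0 ^ 2) ≤ 1 := by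
  rcases le_or_gt y 0 with h0 | h0
  · rw [smoothstep_of_nonpos h0]; norm_num
  rcases le_or_gt y (1 / 2) with h1 | h1
  · rw [max_eq_left h0.le, max_eq_right (by linarith), max_eq_right (by linarith)]; nlinarith
  rcases le_or_gt y 1 with h2 | h2
  · rw [max_eq_left h0.le, max_eq_left (by linarith), max_eq_right (by linarith)]; nlinarith
  · rw [smoothstep_of_one_le h2.le]

/-- **The tent is `min(y₊, (1 − y)₊)`.** [folklore] [cite: Balaban1985BackgroundPropagators, (3.43) p.398] -/
theorem tent_eq_min (y : ℝ) : max y 0 - 2 * max (y - 1 / 2) 0 + max (y - 1) 0 = min (max y 0) (max (1 - y) 0) := by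
  rcases le_or_gt y 0 with h0 | h0
  · rw [max_eq_right h0, max_eq_right (by linarith), max_eq_right (by linarith), max_eq_left (by linarith), min_eq_left (by linarith)]; ring
  rcases le_or_gt y (1 / 2) with h1 | h1
  · rw [max_eq_left h0.le, max_eq_right (by linarith), max_eq_right (by linarith), max_eq_left (by linarith), min_eq_left (by linarith)]; ring
  rcases le_or_gt y 1 with h2 | h2
  · rw [max_eq_left h0.le, max_eq_left (by linarith), max_eq_right (by linarith), max_eq_left (by linarith), min_eq_right (by linarith)]; ring
  · rw [max_eq_left h0.le, max_eq_left (by linarith), max_eq_left (by linarith), max_eq_right (by linarith), min_eq_right (by linarith)]; ring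

/-- `0 ≤ T(y)`. [folklore] [cite: Balaban1985BackgroundPropagators, (3.43) p.398] -/
theorem tent_nonneg (y : ℝ) : 0 ≤ max y 0 - 2 * max (y - 1 / 2) 0 + max (y - 1) 0 := by
  rw [tent_eq_min]; exact le_min (le_max_right _ _) (le_max_right _ _)

/-- `T(y) ≤ ½`. [folklore] [cite: Balaban1985BackgroundPropagators, (3.43) p.398] -/
theorem tent_le_half (y : ℝ) : max y 0 - 2 * max (y - 1 / 2) 0 + max (y - 1) 0 ≤ 1 / 2 := by
  rw [tent_eq_min]
  rcases le_or_gt y (1 / 2) with h | h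
  · exact (min_le_left _ _).trans (max_le h (by norm_num))
  · exact (min_le_right _ _).trans (max_le (by linarith) (by norm_num))

/-- `T(y) = 0` for `y ≤ 0`. [folklore] [cite: Balaban1985BackgroundPropagators, (3.43) p.398] -/
theorem tent_of_nonpos {y : ℝ} (hy : y ≤ 0) : max y 0 - 2 * max (y - 1 / 2) 0 + max (y - 1) 0 = 0 := by
  rw [max_eq_right hy, max_eq_right (by linarith), max_eq_right (by linarith)]; ring

/-- `T(y) = 0` for `y ≥ 1`. [folklore] [cite: Balaban1985BackgroundPropagators, (3.43) p.398] -/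
theorem tent_of_one_le {y : ℝ} (hy : 1 ≤ y) : max y 0 - 2 * max (y - 1 / 2) 0 + max (y - 1) 0 = 0 := by
  rw [max_eq_left (by linarith), max_eq_left (by linarith), max_eq_left (by linarith)]; ring

/-- **The tent is 1-Lipschitz.** [folklore] [cite: Balaban1985BackgroundPropagators, (3.43) p.398] -/
theorem abs_tent_sub_tent_le (x y : ℝ) :
    |(max x 0 - 2 * max (x - 1 / 2) 0 + max (x - 1) 0) - (max y 0 - 2 * max (y - 1 / 2) 0 + max (y - 1) 0)| ≤ |x - y| := by
  rw [tent_eq_min, tent_eq_min]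
  refine (abs_min_sub_min_le_max _ _ _ _).trans (max_le (abs_max_sub_max_le_abs _ _ _) ?_)
  refine (abs_max_sub_max_le_abs _ _ _).trans (le_of_eq ?_)
  rw [show (1 : ℝ) - x - (1 - y) = -(x - y) by ring, abs_neg]

/-! ## §2 The plateau profile -/

/-- **A `C^{1,1}` PLATEAU PROFILE WITH RAMP WIDTH `w`**: for `α ≤ β`, `0 < w` there are `g, g′ : ℝ → ℝ` with `HasDerivAt g (g′ x) x` everywhere, `0 ≤ g ≤ 1`,
`|g′| ≤ 2∕w`, `|g′(x) − g′(y)| ≤ (8∕w²)·|x − y|`, `g = 1` on `[α, β]`, `g = 0` on `(−∞, α − w]` and on `[β + w, ∞)` — the `C^{1,1}` input of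
`B9Eq343ProfileLetters` (`L₁ = 2∕w`, `L₂ = 8∕w²`).  Witness: `g(x) = S((x − α + w)∕w) + S((β + w − x)∕w) − 1` with the smoothstep `S` of §1.
[folklore] [cite: Balaban1985BackgroundPropagators, (3.43)–(3.46) p.398] -/
theorem exists_plateau_profile {α β w : ℝ} (hαβ : α ≤ β) (hw : 0 < w) :
    ∃ g g' : ℝ → ℝ, (∀ x, HasDerivAt g (g' x) x) ∧ (∀ x, 0 ≤ g x) ∧ (∀ x, g x ≤ 1) ∧ (∀ x, |g' x| ≤ 2 / w) ∧
      (∀ x y, |g' x - g' y| ≤ 8 / w ^ 2 * |x - y|) ∧ (∀ x, α ≤ x → x ≤ β → g x = 1) ∧ (∀ x, x ≤ α - w → g x = 0) ∧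
      (∀ x, β + w ≤ x → g x = 0) := by
  -- the smoothstep and the tent, inline
  set S : ℝ → ℝ := fun s => 2 * (max s 0 ^ 2 - 2 * max (s - 1 / 2) 0 ^ 2 + max (s - 1) 0 ^ 2) with hS
  set T : ℝ → ℝ := fun s => max s 0 - 2 * max (s - 1 / 2) 0 + max (s - 1) 0 with hT
  have hSd : ∀ y, HasDerivAt S (4 * T y) y := fun y => hasDerivAt_smoothstep y
  have hw0 : w ≠ 0 := hw.ne'
  -- the two affine arguments
  have hu : ∀ x, HasDerivAt (fun s : ℝ => (s - (α - w)) / w) (1 / w) x := fun x => by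
    simpa using ((hasDerivAt_id x).sub_const (α - w)).div_const w
  have hd : ∀ x, HasDerivAt (fun s : ℝ => ((β + w) - s) / w) (-(1 / w)) x := fun x => by
    have h := ((hasDerivAt_id x).const_sub (β + w)).div_const w
    simpa [neg_div] using h
  refine ⟨fun x => S ((x - (α - w)) / w) + S (((β + w) - x) / w) - 1,
    fun x => 4 * T ((x - (α - w)) / w) * (1 / w) + 4 * T (((β + w) - x) / w) * (-(1 / w)), fun x => ?_, fun x => ?_, fun x => ?_, fun x => ?_,
    fun x y => ?_, fun x h1 h2 => ?_, fun x hx => ?_, fun x hx => ?_⟩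
  · -- derivative
    exact (((hSd _).comp x (hu x)).add ((hSd _).comp x (hd x))).sub_const 1
  · -- 0 ≤ g
    simp only [hS]
    rcases le_or_gt x α with h | h
    · rw [smoothstep_of_one_le (show (1 : ℝ) ≤ ((β + w) - x) / w by rw [le_div_iff₀ hw]; linarith)]
      linarith [smoothstep_nonneg ((x - (α - w)) / w)]
    · rw [smoothstep_of_one_le (show (1 : ℝ) ≤ (x - (α - w)) / w by rw [le_div_iff₀ hw]; linarith)]
      linarith [smoothstep_nonneg (((β + w) - x) / w)]
  · -- g ≤ 1
    simp only [hS]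
    linarith [smoothstep_le_one ((x - (α - w)) / w), smoothstep_le_one (((β + w) - x) / w)]
  · -- |g′| ≤ 2/w : at most one ramp is active
    simp only [hT]
    rcases le_or_gt x α with h | h
    · rw [tent_of_one_le (show (1 : ℝ) ≤ ((β + w) - x) / w by rw [le_div_iff₀ hw]; linarith), mul_zero, zero_mul, add_zero, abs_mul,
        abs_of_pos (by positivity : (0 : ℝ) < 1 / w), abs_mul, abs_of_pos (by norm_num : (0 : ℝ) < 4), abs_of_nonneg (tent_nonneg _)]
      have := tent_le_half ((x - (α - w)) / w)
      calc 4 * (max ((x - (α - w)) / w) 0 - 2 * max ((x - (α - w)) / w - 1 / 2) 0 + max ((x - (α - w)) / w - 1) 0) * (1 / w)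
          ≤ 4 * (1 / 2) * (1 / w) := by gcongr
        _ = 2 / w := by ring
    · rw [tent_of_one_le (show (1 : ℝ) ≤ (x - (α - w)) / w by rw [le_div_iff₀ hw]; linarith), mul_zero, zero_mul, zero_add, abs_mul, abs_neg,
        abs_of_pos (by positivity : (0 : ℝ) < 1 / w), abs_mul, abs_of_pos (by norm_num : (0 : ℝ) < 4), abs_of_nonneg (tent_nonneg _)]
      have := tent_le_half (((β + w) - x) / w)
      calc 4 * (max (((β + w) - x) / w) 0 - 2 * max (((β + w) - x) / w - 1 / 2) 0 + max (((β + w) - x) / w - 1) 0) * (1 / w)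
          ≤ 4 * (1 / 2) * (1 / w) := by gcongr
        _ = 2 / w := by ring
  · -- g′ is (8/w²)-Lipschitz
    have e : (4 * T ((x - (α - w)) / w) * (1 / w) + 4 * T (((β + w) - x) / w) * (-(1 / w))) -
        (4 * T ((y - (α - w)) / w) * (1 / w) + 4 * T (((β + w) - y) / w) * (-(1 / w))) =
        (4 / w) * ((T ((x - (α - w)) / w) - T ((y - (α - w)) / w)) - (T (((β + w) - x) / w) - T (((β + w) - y) / w))) := by ring
    rw [e, abs_mul, abs_of_pos (by positivity : (0 : ℝ) < 4 / w)]
    have h1 : |T ((x - (α - w)) / w) - T ((y - (α - w)) / w)| ≤ |x - y| / w := by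
      have h := abs_tent_sub_tent_le ((x - (α - w)) / w) ((y - (α - w)) / w)
      have d1 : |(x - (α - w)) / w - (y - (α - w)) / w| = |x - y| / w := by
        rw [← sub_div, abs_div, abs_of_pos hw, show x - (α - w) - (y - (α - w)) = x - y by ring]
      simp only [hT]; rw [d1] at h; exact h
    have h2 : |T (((β + w) - x) / w) - T (((β + w) - y) / w)| ≤ |x - y| / w := by
      have h := abs_tent_sub_tent_le (((β + w) - x) / w) (((β + w) - y) / w)
      have d2 : |((β + w) - x) / w - ((β + w) - y) / w| = |x - y| / w := by
        rw [← sub_div, abs_div, abs_of_pos hw, show (β + w) - x - ((β + w) - y) = -(x - y) by ring, abs_neg]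
      simp only [hT]; rw [d2] at h; exact h
    calc 4 / w * |(T ((x - (α - w)) / w) - T ((y - (α - w)) / w)) - (T (((β + w) - x) / w) - T (((β + w) - y) / w))|
        ≤ 4 / w * (|x - y| / w + |x - y| / w) := by
          gcongr
          exact (abs_sub _ _).trans (add_le_add h1 h2)
      _ = 8 / w ^ 2 * |x - y| := by field_simp; ring
  · -- g = 1 on [α, β]
    simp only [hS]
    rw [smoothstep_of_one_le (show (1 : ℝ) ≤ (x - (α - w)) / w by rw [le_div_iff₀ hw]; linarith),
      smoothstep_of_one_le (show (1 : ℝ) ≤ ((β + w) - x) / w by rw [le_div_iff₀ hw]; linarith)]; ring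
  · -- g = 0 left of α − w
    simp only [hS]
    rw [smoothstep_of_nonpos (div_nonpos_of_nonpos_of_nonneg (by linarith : x - (α - w) ≤ 0) hw.le),
      smoothstep_of_one_le (show (1 : ℝ) ≤ ((β + w) - x) / w by rw [le_div_iff₀ hw]; linarith)]; ring
  · -- g = 0 right of β + w
    simp only [hS]
    rw [smoothstep_of_one_le (show (1 : ℝ) ≤ (x - (α - w)) / w by rw [le_div_iff₀ hw]; linarith),
      smoothstep_of_nonpos (div_nonpos_of_nonpos_of_nonneg (by linarith : (β + w) - x ≤ 0) hw.le)]; ring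

end Literature.MathematicalPhysics.QuantumFieldTheory.Balaban1983to89.B9Eq343PlateauProfile

end
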